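import Literature.Probability.LatticeModels.TorusBlockExponentialKernel
import Literature.Probability.LatticeModels.TorusCyclicDistanceNegType
import Summits.HubbardSuperconductivity.HubbardSuperconductivity.Theorems.LevyLogBootstrapBlock2InfDivXXZLevyEquivalence
import HarnessLib

/-!
# Crux `Block2InfDivXXZ` (stmt-HubbardSuperconductivity-15048) — calibration:
# the crux's conclusion FAILS for the cyclic-exponential ("massive") kernel, at every block size

Crux workfile (`Cruxes/Block2InfDivXXZ/ExponentialKernelNotBlockID.lean`; explainer `.md` alongside).
The Literature theorem `TorusBlock.expKernel_not_isNegDefKernel_negLog_blockKernel`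
(`Literature/Probability/LatticeModels/TorusBlockExponentialKernel.lean`, p164360) says that for
`K(x, y) = λ^{d_M(x₀-y₀) + d_M(x₁-y₁)}` on `(ℤ/bm)²` (`b ≥ 2`, `m ≥ 4` even, `0 < λ < 1`) the `b`-block
kernel `K_b` has `-log K_b` NOT negative definite (its Lévy coefficient at `q = (2,0)` is
`m·log(GM²/AM²) < 0`). Here this is put in the LITERAL SHAPE of the crux's conclusion — "every
fractional Hadamard power `t ∈ (0,1]` of the `M²×M²` block matrix is positive semidefinite" — via
the Summits-side Schoenberg direction `isNegDefKernel_negLog_of_posSemidef_rpow`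
(`Theorems/LevyLogBootstrapBlock2InfDivXXZLevyEquivalence.lean`):

* `expBlockKernel_pos`, `expBlockKernel_symm` — the block matrix is entrywise positive and symmetric;
* `expKernel_blockRpow_not_all_posSemidef` — NOT all Hadamard powers `t ∈ (0,1]` of the block matrix
  are positive semidefinite;
* `expKernel_site_negLogType_and_block_not` — CONTRAST in one statement: the SITE kernel `K` has
  `-log K` of negative type (it is infinitely divisible: the cyclic distance on an even cycle is
  hypercube-embeddable, `Literature/…/TorusCyclicDistanceNegType.lean`, p165101), while its
  `b`-block kernel has not — for the massive kernel, blocking DESTROYS infinite divisibility at every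
  block size, whereas the crux asserts that 2×2-blocking CREATES it for the ground-state kernel.

So the statement `Block2InfDivXXZ` with the ground-state transverse kernel replaced by a positive,
symmetric, translation-invariant, exponentially decaying kernel is FALSE (for every block size, not
only `b = 2`): whatever proves the crux must use an input that the massive kernel violates — slow
(order-type) decay. Sorry-free; no definition.
-/

noncomputable section

set_option linter.dupNamespace false

open Finset Complex
open scoped BigOperators

namespace Summit.HubbardSuperconductivity.HubbardSuperconductivity.Cruxes.Block2InfDivXXZ.ExponentialKernel

open Literature.Analysis.Matrix Literature.Probability.LatticeModels
open Literature.Probability.LatticeModels.TorusBlock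
open Summit.HubbardSuperconductivity.HubbardSuperconductivity.Theorems.LevyLogBootstrap

variable {b m M : ℕ} [NeZero M] [NeZero m]

/-- **The block matrix of the cyclic-exponential kernel is entrywise positive** (`0 < λ`,
`M = b·m`): `K_b(x,y) = k_b(βx - βy) = g · g > 0`. [folklore] -/
theorem expBlockKernel_pos (hM : M = b * m) {lam : ℝ} (hlam : 0 < lam) (x y : TorusSite 2 M) :
    0 < ∑ x' : TorusSite 2 M, ∑ y' : TorusSite 2 M,
      if (∀ i : Fin 2, (x' i).val / b = (x i).val / b) ∧ (∀ i : Fin 2, (y' i).val / b = (y i).val / b)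
      then lam ^ (∑ i : Fin 2, min (x' i - y' i).val (M - (x' i - y' i).val)) else 0 := by
  classical
  have hb : 0 < b := pos_of_eq_mul hM
  have hne : (univ : Finset (Fin b)).Nonempty := ⟨⟨0, hb⟩, mem_univ _⟩
  have hT : ∀ v x y : TorusSite 2 M,
      lam ^ (∑ i : Fin 2, min ((x + v) i - (y + v) i).val (M - ((x + v) i - (y + v) i).val)) =
        lam ^ (∑ i : Fin 2, min (x i - y i).val (M - (x i - y i).val)) := fun v x y => by
    simp only [Pi.add_apply, add_sub_add_right_eq_sub]
  rw [blockKernel_eq_coarse hM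
    (fun x y : TorusSite 2 M => lam ^ (∑ i : Fin 2, min (x i - y i).val (M - (x i - y i).val))) hT x y,
    expKernel_coarse_eq_prod]
  refine Finset.prod_pos fun i _ => ?_
  rw [sum_sum_block_eq hM _ (fun s' t => lam ^ min (s' - t).val (M - (s' - t).val))]
  exact Finset.sum_pos (fun s _ => Finset.sum_pos (fun t _ => pow_pos hlam _) hne) hne

omit [NeZero m] in
/-- **The block matrix of the cyclic-exponential kernel is symmetric** (swap the two block sums and
use `d_M(-u) = d_M(u)`). [folklore] -/
theorem expBlockKernel_symm (lam : ℝ) (x y : TorusSite 2 M) :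
    (∑ x' : TorusSite 2 M, ∑ y' : TorusSite 2 M,
      if (∀ i : Fin 2, (x' i).val / b = (x i).val / b) ∧ (∀ i : Fin 2, (y' i).val / b = (y i).val / b)
      then lam ^ (∑ i : Fin 2, min (x' i - y' i).val (M - (x' i - y' i).val)) else 0) =
    ∑ x' : TorusSite 2 M, ∑ y' : TorusSite 2 M,
      if (∀ i : Fin 2, (x' i).val / b = (y i).val / b) ∧ (∀ i : Fin 2, (y' i).val / b = (x i).val / b)
      then lam ^ (∑ i : Fin 2, min (x' i - y' i).val (M - (x' i - y' i).val)) else 0 := by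
  rw [Finset.sum_comm]
  refine Finset.sum_congr rfl fun y' _ => Finset.sum_congr rfl fun x' _ => ?_
  have hS : lam ^ (∑ i : Fin 2, min (x' i - y' i).val (M - (x' i - y' i).val)) =
      lam ^ (∑ i : Fin 2, min (y' i - x' i).val (M - (y' i - x' i).val)) := by
    congr 1
    refine Finset.sum_congr rfl fun i _ => ?_
    rw [← cyclicDist_neg (x' i - y' i), neg_sub]
  rw [hS]
  exact if_congr and_comm rfl rfl

/-- **`Block2InfDivXXZ`'s conclusion fails for the massive kernel, at every block size.** For
`M = b·m`, `b ≥ 2`, `m = 2k ≥ 4`, `0 < λ < 1`: it is NOT true that every fractional Hadamard power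
`t ∈ (0, 1]` of the `M² × M²` block matrix
`(x, y) ↦ Σ_{x' ∈ block x, y' ∈ block y} λ^{d_M(x'₀-y'₀)+d_M(x'₁-y'₁)}` (block membership
`∀ i, (x' i).val / b = (x i).val / b`, exactly as in the route decl with `2 ↦ b`) is positive
semidefinite. (`expKernel_not_isNegDefKernel_negLog_blockKernel` + the Schoenberg direction
`isNegDefKernel_negLog_of_posSemidef_rpow`.) [folklore] -/
theorem expKernel_blockRpow_not_all_posSemidef (hM : M = b * m) (hb : 2 ≤ b) {k : ℕ}
    (hk : m = k + k) (hk2 : 2 ≤ k) {lam : ℝ} (hlam : 0 < lam) (hlam1 : lam < 1) :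
    ¬ ∀ t : ℝ, 0 < t → t ≤ 1 →
      (Matrix.of fun x y : TorusSite 2 M =>
        (∑ x' : TorusSite 2 M, ∑ y' : TorusSite 2 M,
          if (∀ i : Fin 2, (x' i).val / b = (x i).val / b) ∧
              (∀ i : Fin 2, (y' i).val / b = (y i).val / b)
          then lam ^ (∑ i : Fin 2, min (x' i - y' i).val (M - (x' i - y' i).val)) else 0) ^ t).PosSemidef := by
  classical
  intro h
  exact expKernel_not_isNegDefKernel_negLog_blockKernel hM hb hk hk2 hlam hlam1
    (isNegDefKernel_negLog_of_posSemidef_rpow _ (fun x y => expBlockKernel_pos hM hlam x y)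
      (fun x y => expBlockKernel_symm lam x y) h)

/-- **Site-ID but not block-ID.** For `M = b·m`, `b ≥ 2`, `m = 2k ≥ 4`, `0 < λ < 1`, the
cyclic-exponential kernel `K(x,y) = λ^{d_M(x₀-y₀)+d_M(x₁-y₁)}` on `(ℤ/M)²` has `-log K` negative
definite (all Hadamard powers of the SITE kernel are positive definite —
`isNegDefKernel_negLog_cyclicExpKernel`), but `-log K_b` of its `b`-block kernel is NOT
(`expKernel_not_isNegDefKernel_negLog_blockKernel`). [folklore] -/
theorem expKernel_site_negLogType_and_block_not (hM : M = b * m) (hb : 2 ≤ b) {k : ℕ}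
    (hk : m = k + k) (hk2 : 2 ≤ k) {lam : ℝ} (hlam : 0 < lam) (hlam1 : lam < 1) :
    IsNegDefKernel (fun x y : TorusSite 2 M =>
        -Real.log (lam ^ (∑ i : Fin 2, min (x i - y i).val (M - (x i - y i).val)))) ∧
      ¬ IsNegDefKernel (fun x y : TorusSite 2 M => -Real.log (∑ x' : TorusSite 2 M, ∑ y' : TorusSite 2 M,
        if (∀ i : Fin 2, (x' i).val / b = (x i).val / b) ∧ (∀ i : Fin 2, (y' i).val / b = (y i).val / b)
        then lam ^ (∑ i : Fin 2, min (x' i - y' i).val (M - (x' i - y' i).val)) else 0)) := by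
  have hMe : M = b * k + b * k := by rw [hM, hk, Nat.mul_add]
  exact ⟨isNegDefKernel_negLog_cyclicExpKernel hMe hlam hlam1.le,
    expKernel_not_isNegDefKernel_negLog_blockKernel hM hb hk hk2 hlam hlam1⟩

end Summit.HubbardSuperconductivity.HubbardSuperconductivity.Cruxes.Block2InfDivXXZ.ExponentialKernel

end
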